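import Mathlib
import HarnessLib
import Literature.Analysis.FluidPDE.LocalTypeIReverseTools
import Summits.NavierStokesRegularity.NavierStokesRegularity.Theorems.TypeIQuarterGateScarZoomDefs
import Summits.NavierStokesRegularity.NavierStokesRegularity.Theorems.TypeICertificateLadderNoTypeIBlowupTypeIMorrey

/-!
# Crux `TypeIQuarterGate.ScarEnvelopeTypeI` (stmt-NavierStokesRegularity-23843), line `slice_budget` —
# the NEAR-MISS OF RECORD as a theorem: the TIME-AVERAGED octave budget holds under the crux hypotheses

The deciding stub SD `stub_sliceOctaveBudget` of line `slice_budget` asks, at a scar `a` of a Type-I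
blow-up, for the SLICE-WISE annular cube bound `∫_{ℓ<|y−a|<eℓ} |u(t, y)|³ dy ≤ q` at every late time
`t` and every admissible radius `ℓ`.  The line card's «measured deficit» is that the tree bounds this
cube only ON PARABOLIC TIME AVERAGE.  This file makes that near-miss a kernel-checked statement in
SD's own currency (`timeAveragedOctaveBudget_of_cruxHypotheses`): under `CruxHypotheses ν T u p` alone
(no singularity, tameness or budget hypothesis), at EVERY point `a` there are `q, δ, r₀ > 0` with

  `∫_{t − ℓ²/ν}^{t} ∫_{ℓ<|y−a|<eℓ} |u(s, y)|³ dy ds ≤ q · ℓ²/ν`   for `t ∈ (T − δ, T)`, `0 < ℓ ≤ r₀`,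

i.e. the cube averaged over the natural parabolic window of duration `ℓ²/ν` ending at `t` is `≤ q` —
whereas SD asks `≤ q` at each single time.  Proof: the Morrey bound of a Type-I solution
(`morrey_of_typeI`, Seregin–Šverák 2009 L.3.5 / Barker–Prange 2020) and the viscosity-normalising
zoom about `(T, a)` (`exists_zoom_typeIBound_lt_top_of_morrey`, Albritton–Barker 2019 L.2.6) give
`𝐈(Q(0, ½)) < ∞` for `v = α u(T + β·, a + R·)`, `β = R²/ν`, `α = R/ν`; in particular
`C(r; z') = r⁻² ∫∫_{Q(z', r)} |v|³ ≤ 𝐈` for every sub-cylinder, and the window × annulus above is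
the image of a sub-cylinder `Q((s₁, 0), eℓ/R)` (change of variables `setLIntegral_enorm_pow_stRescale`;
the constant is `q = e² ν³ 𝐈`).

HONEST FRAMING: this is the near-miss, not SD; SD (slice-wise), the crux, its parent and the summit
are OPEN, and nothing here is credited toward them.
-/

noncomputable section

-- the summit-side namespace `Summit.NavierStokesRegularity.NavierStokesRegularity.…` (single-conjunct
-- summit, D-0017) repeats a component by design; the dupNamespace linter would flag every declaration.
set_option linter.dupNamespace false

namespace Summit.NavierStokesRegularity.NavierStokesRegularity.Cruxes.ScarEnvelopeTypeI.SliceBudget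

open MeasureTheory Set Function Filter Topology TopologicalSpace Metric
open scoped NNReal ENNReal
open Literature.Analysis Literature.Analysis.FluidPDE
open Summit.NavierStokesRegularity.NavierStokesRegularity.Cruxes.ScarEnvelopeTypeI.ScarZoom (CruxHypotheses)

/-- **The TIME-AVERAGED octave budget under the crux hypotheses** (the near-miss of record of line
`slice_budget`, in the currency of its deciding stub SD).  For a maximal smooth Leray–Hopf solution
from rapidly decaying data with sup-norm Type-I blow-up at `T` (`CruxHypotheses`), at every point
`a` there are `q, δ, r₀ > 0` such that for all `t ∈ (T − δ, T)` and `0 < ℓ ≤ r₀` the cube of `u` on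
the e-annulus `{ℓ < |y − a| < eℓ}`, integrated over the parabolic window `(t − ℓ²/ν, t)`, is at most
`q · ℓ²/ν`.  (SD asks for `≤ q` on the annulus at EACH time `t`.) -/
theorem timeAveragedOctaveBudget_of_cruxHypotheses {ν T : ℝ}
    {u : ℝ → EuclideanSpace ℝ (Fin 3) → EuclideanSpace ℝ (Fin 3)}
    {p : ℝ → EuclideanSpace ℝ (Fin 3) → ℝ} (hH : CruxHypotheses ν T u p)
    (a : EuclideanSpace ℝ (Fin 3)) :
    ∃ q δ r₀ : ℝ, 0 < δ ∧ 0 < r₀ ∧ ∀ t ∈ Ioo (T - δ) T, ∀ ℓ : ℝ, 0 < ℓ → ℓ ≤ r₀ →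
      ∫⁻ w in Ioo (t - ℓ ^ 2 / ν) t ×ˢ
          {y : EuclideanSpace ℝ (Fin 3) | ℓ < ‖y - a‖ ∧ ‖y - a‖ < Real.exp 1 * ℓ},
        ‖u w.1 w.2‖ₑ ^ (3 : ℝ) ≤ ENNReal.ofReal (q * (ℓ ^ 2 / ν)) := by
  obtain ⟨hν, hT, hmax, hLH, -, hTI, -⟩ := hH
  have hsol := hmax.1
  -- ## the Morrey bound and the viscosity-normalising zoom about `(T, a)`
  obtain ⟨r₀, M₀, T₁, hr₀, hT₁, hMor⟩ :=
    Summit.NavierStokesRegularity.NavierStokesRegularity.Theorems.morrey_of_typeI hν hT hsol hLH hTI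
  obtain ⟨R, α, β, hR, hα, hβ, hβν, hαν, -, -, -, htypeI⟩ :=
    Summit.NavierStokesRegularity.NavierStokesRegularity.Theorems.exists_zoom_typeIBound_lt_top_of_morrey
      hν hT hsol hLH hr₀ hT₁ hMor a
  set q' : ℝ → EuclideanSpace ℝ (Fin 3) → ℝ :=
    fun t x => p t x - (p t 0 - normalisedPressure (u t) 0) with hq'
  set v : ℝ → EuclideanSpace ℝ (Fin 3) → EuclideanSpace ℝ (Fin 3) := α • stPull β R T a u with hv
  set πv : ℝ → EuclideanSpace ℝ (Fin 3) → ℝ := α ^ 2 • stPull β R T a q' with hπv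
  set Gv : ℝ → EuclideanSpace ℝ (Fin 3) → EuclideanSpace ℝ (Fin 3) →L[ℝ] EuclideanSpace ℝ (Fin 3) :=
    (α * R) • stPull β R T a (fun t x => fderiv ℝ (u t) x) with hGvdef
  set Itot : ℝ≥0∞ := typeIBound (parabolicCylinder (1 / 2) (0 : ℝ × EuclideanSpace ℝ (Fin 3))) v πv Gv
    with hIdef
  have hItop : Itot ≠ ⊤ := htypeI.ne
  have hexp : 0 < Real.exp 1 := Real.exp_pos 1
  -- ## the constants
  set c₀ : ℝ := α ^ 3 * (β * R ^ 3)⁻¹ with hc₀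
  have hc₀pos : 0 < c₀ := by positivity
  refine ⟨Real.exp 1 ^ 2 * ν ^ 3 * Itot.toReal, β / 8, R / (4 * Real.exp 1), by positivity, by positivity,
    fun t ht ℓ hℓ hℓr => ?_⟩
  -- ## the sub-cylinder `Q((s₁, 0), r)` of `Q(0, 1/2)`, `s₁ = (t − T)/β`, `r = eℓ/R`
  set s₁ : ℝ := (t - T) / β with hs₁
  set r : ℝ := Real.exp 1 * ℓ / R with hr
  have hrpos : 0 < r := by positivity
  have hr4 : r ≤ 1 / 4 := by
    rw [hr, div_le_iff₀ hR]
    have := (le_div_iff₀ (by positivity : (0 : ℝ) < 4 * Real.exp 1)).1 hℓr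
    nlinarith
  have hs₁neg : s₁ < 0 := div_neg_of_neg_of_pos (by linarith [ht.2]) hβ
  have hs₁lb : -(1 / 8 : ℝ) < s₁ := by
    rw [hs₁, lt_div_iff₀ hβ]
    linarith [ht.1]
  set z₁ : ℝ × EuclideanSpace ℝ (Fin 3) := (s₁, (0 : EuclideanSpace ℝ (Fin 3))) with hz₁
  have hsub : parabolicCylinder r z₁ ⊆ parabolicCylinder (1 / 2) (0 : ℝ × EuclideanSpace ℝ (Fin 3)) := by
    intro w hw
    rw [mem_parabolicCylinder] at hw ⊢
    simp only [hz₁, Prod.fst_zero, Prod.snd_zero, zero_sub] at hw ⊢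
    obtain ⟨⟨h1, h2⟩, h3⟩ := hw
    have hr2 : r ^ 2 ≤ 1 / 16 := by nlinarith
    refine ⟨⟨by nlinarith, by linarith⟩, by linarith⟩
  have hC : cknC r z₁ v ≤ Itot := cknC_le_abScaledSum.trans (abScaledSum_le_typeIBound hrpos hsub)
  -- `∫∫_{Q((s₁,0), r)} |v|³ ≤ r² Itot`
  have hQv : ∫⁻ w in parabolicCylinder r z₁, ‖v w.1 w.2‖ₑ ^ (3 : ℕ) ≤ ENNReal.ofReal (r ^ 2) * Itot := by
    have h1 : (ENNReal.ofReal r ^ 2)⁻¹ * ∫⁻ w in parabolicCylinder r z₁, ‖v w.1 w.2‖ₑ ^ (3 : ℕ) ≤ Itot := hC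
    rw [← ENNReal.ofReal_pow hrpos.le] at h1
    have hr0 : ENNReal.ofReal (r ^ 2) ≠ 0 := (ENNReal.ofReal_pos.2 (by positivity)).ne'
    exact (ENNReal.inv_mul_le_iff hr0 ENNReal.ofReal_ne_top).1 h1
  -- ## the window × annulus is the image of a subset of that cylinder
  set S : Set (ℝ × EuclideanSpace ℝ (Fin 3)) := Ioo (t - β * r ^ 2) t ×ˢ ball a (R * r) with hS
  have hpre : stAffine β R T a ⁻¹' S ⊆ parabolicCylinder r z₁ := by
    rintro ⟨s, y⟩ hw
    rw [mem_preimage, hS, stAffine_apply, mem_prod, mem_Ioo, mem_ball, dist_eq_norm,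
      add_sub_cancel_left, norm_smul, Real.norm_of_nonneg hR.le] at hw
    obtain ⟨⟨h1, h2⟩, h3⟩ := hw
    rw [mem_parabolicCylinder]
    simp only [hz₁, dist_zero_right]
    refine ⟨⟨?_, ?_⟩, lt_of_mul_lt_mul_left h3 hR.le⟩
    · rw [hs₁, div_sub' (hc := hβ.ne'), div_lt_iff₀ hβ]
      linarith
    · rw [hs₁, lt_div_iff₀ hβ]
      linarith
  have htarget : Ioo (t - ℓ ^ 2 / ν) t ×ˢ
      {y : EuclideanSpace ℝ (Fin 3) | ℓ < ‖y - a‖ ∧ ‖y - a‖ < Real.exp 1 * ℓ} ⊆ S := by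
    have hβr : β * r ^ 2 = Real.exp 1 ^ 2 * ℓ ^ 2 / ν := by
      rw [hβν, hr]; field_simp
    have hRr : R * r = Real.exp 1 * ℓ := by rw [hr]; field_simp
    rintro ⟨s, y⟩ ⟨hs, hy⟩
    rw [mem_Ioo] at hs
    refine ⟨⟨?_, hs.2⟩, ?_⟩
    · rw [hβr]
      have h1 : ℓ ^ 2 / ν ≤ Real.exp 1 ^ 2 * ℓ ^ 2 / ν := by
        rw [div_le_div_iff_of_pos_right hν]
        have he1 : 1 ≤ Real.exp 1 ^ 2 := by nlinarith [Real.add_one_le_exp (1 : ℝ)]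
        nlinarith [sq_nonneg ℓ]
      linarith [hs.1]
    · rw [mem_ball, dist_eq_norm, hRr]
      exact hy.2
  -- ## change of variables and the constant
  have hcov := setLIntegral_enorm_pow_stRescale hβ hR T a α u S 3
  rw [finrank_euclideanSpace_fin] at hcov
  -- `c₀ ∫_S |u|³ = ∫_{Φ⁻¹ S} |v|³ ≤ r² Itot`
  have hconst : ‖α‖ₑ ^ 3 * ENNReal.ofReal (β * R ^ 3)⁻¹ = ENNReal.ofReal c₀ := by
    rw [Real.enorm_eq_ofReal hα.le, ← ENNReal.ofReal_pow hα.le, ← ENNReal.ofReal_mul (by positivity),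
      hc₀]
  have hSle : ENNReal.ofReal c₀ * ∫⁻ w in S, ‖u w.1 w.2‖ₑ ^ (3 : ℕ) ≤ ENNReal.ofReal (r ^ 2) * Itot := by
    rw [← hconst, ← hcov]
    exact (lintegral_mono_set hpre).trans hQv
  have hSle' : ∫⁻ w in S, ‖u w.1 w.2‖ₑ ^ (3 : ℕ) ≤ ENNReal.ofReal (c₀⁻¹ * (r ^ 2 * Itot.toReal)) := by
    calc ∫⁻ w in S, ‖u w.1 w.2‖ₑ ^ (3 : ℕ)
        = ENNReal.ofReal c₀⁻¹ * (ENNReal.ofReal c₀ * ∫⁻ w in S, ‖u w.1 w.2‖ₑ ^ (3 : ℕ)) := by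
          rw [← mul_assoc, ← ENNReal.ofReal_mul (inv_nonneg.2 hc₀pos.le), inv_mul_cancel₀ hc₀pos.ne',
            ENNReal.ofReal_one, one_mul]
      _ ≤ ENNReal.ofReal c₀⁻¹ * (ENNReal.ofReal (r ^ 2) * Itot) := mul_le_mul' le_rfl hSle
      _ = ENNReal.ofReal (c₀⁻¹ * (r ^ 2 * Itot.toReal)) := by
          rw [← ENNReal.ofReal_toReal hItop, ← ENNReal.ofReal_mul (sq_nonneg r),
            ← ENNReal.ofReal_mul (inv_nonneg.2 hc₀pos.le), ENNReal.ofReal_toReal hItop]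
  have hval : c₀⁻¹ * (r ^ 2 * Itot.toReal) = Real.exp 1 ^ 2 * ν ^ 3 * Itot.toReal * (ℓ ^ 2 / ν) := by
    rw [hc₀, hr, hαν, hβν]
    field_simp
  -- ## conclusion
  have e3 : ∀ w : ℝ × EuclideanSpace ℝ (Fin 3), ‖u w.1 w.2‖ₑ ^ (3 : ℝ) = ‖u w.1 w.2‖ₑ ^ (3 : ℕ) := by
    intro w
    exact_mod_cast ENNReal.rpow_natCast ‖u w.1 w.2‖ₑ 3
  calc ∫⁻ w in Ioo (t - ℓ ^ 2 / ν) t ×ˢ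
          {y : EuclideanSpace ℝ (Fin 3) | ℓ < ‖y - a‖ ∧ ‖y - a‖ < Real.exp 1 * ℓ}, ‖u w.1 w.2‖ₑ ^ (3 : ℝ)
      = ∫⁻ w in Ioo (t - ℓ ^ 2 / ν) t ×ˢ
          {y : EuclideanSpace ℝ (Fin 3) | ℓ < ‖y - a‖ ∧ ‖y - a‖ < Real.exp 1 * ℓ},
          ‖u w.1 w.2‖ₑ ^ (3 : ℕ) := lintegral_congr fun w => e3 w
    _ ≤ ∫⁻ w in S, ‖u w.1 w.2‖ₑ ^ (3 : ℕ) := lintegral_mono_set htarget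
    _ ≤ ENNReal.ofReal (c₀⁻¹ * (r ^ 2 * Itot.toReal)) := hSle'
    _ = ENNReal.ofReal (Real.exp 1 ^ 2 * ν ^ 3 * Itot.toReal * (ℓ ^ 2 / ν)) := by rw [hval]

end Summit.NavierStokesRegularity.NavierStokesRegularity.Cruxes.ScarEnvelopeTypeI.SliceBudget

end
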